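import Literature.Geometry.Kaehler.CyclotomicCMTypesDegreeLeEightAllPowersHodgeConjecture
import Literature.Geometry.Kaehler.CyclotomicFermatTwentyFourSimpleFactorsHodgeConjecture
import HarnessLib

/-!
# The Koblitz–Rohrlich factor types of the Fermat curves of degree `m`, `φ(m) ≤ 8`: EVERY realisation — simple or a power of a smaller CM
# variety — satisfies the Hodge conjecture with all its powers

Layer `Literature/Geometry/Kaehler`, namespace `Literature.Geometry.Kaehler.ComplexTorus`; lane `lit-hodgefound` (Track 2 foundations library),
prover seat `lit-hodgefound-p10`, generation 33, row «A2-26(hk)» (self-proposed 2026-08-28).  Theorems only; no `def`, no instance, no named fact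
(net Literature debt 0).

The sibling `CyclotomicFermatTwentyFourSimpleFactorsHodgeConjecture` treated the SIMPLE class at level `24` (`H_{1,3,20}`); its honest column left
the `157` elliptic-type triples (`A ∼ E⁴`) aside.  This generation's `CyclotomicCMTypesDegreeLeEightAllPowersHodgeConjecture` (EVERY CM type of
`ℚ(ζ_m)`, `m > 2`, `φ(m) ≤ 8`: `B•(Aⁿ) ⊗ ℂ = D•(Aⁿ) ⊗ ℂ` and the Hodge conjecture for all powers) closes this: for EVERY admissible triple
`(r, s, t)` modulo such an `m` and EVERY realisation `A` of the Koblitz–Rohrlich type `Φ_{H_{r,s,t}}` (a CM type of `ℚ(ζ_m)`), all powers of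
`A` satisfy the Hodge conjecture — at `m = 24`: the simple fourfold `L_{1,3,20}` AND the `E⁴`-type factors; likewise `m = 15, 20, 30`
(where Aoki's criterion, tree `hodgeConjectureFor_pow_fermat`, does not apply: `p^i ≢ −1`) and all `m` with `φ(m) ≤ 6`.

* **`hodgeClassSpan_pow_eq_and_hodgeConjectureFor_pow_fermat_of_totient_le_eight`**, **`hodgeConjectureFor_pow_fermat_of_totient_le_eight`**
  (any level `m > 2` with `φ(m) ≤ 8`, any admissible K–R type, any realisation, any power),
  **`hodgeConjectureFor_pow_fermat_twentyFour`** (level `24`, ALL triples — BCIR's `F₂₄ ∼ [ℂ⁴/L_{1,3,20}]^{24} ⊕ [157 elliptic curves]` read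
  type by type), `hodgeConjectureFor_pow_fermat_twentyFour_dichotomy` (with the sibling's dichotomy: simple fourfold or `E⁴`-type, HC in both cases).

Honest column: `F_m`, `J(F_m)` and `J(F_m) ∼ ∏ L_{r,s,t}` are NOT constructed (as in all the lane's Fermat files); the statements are about the
realisations of the factor TYPES.

## References

* [BauerCosteItzyksonRuelle1997] M. Bauer, A. Coste, C. Itzykson, P. Ruelle, J. Geom. Phys. 22 (1997), §3.3–3.4.
* [KoblitzRohrlich1978] N. Koblitz, D. Rohrlich, Canad. J. Math. 30 (1978), §1 p. 1184.
* [Gordon1999HodgeAVSurvey] B. B. Gordon (1999), Thm. 6.4, §9.3, §9.4.2.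
* [Hazama2003CyclicCM] F. Hazama, J. Math. Sci. Univ. Tokyo 10 (2003), p. 582.
-/

noncomputable section

open scoped Classical nonZeroDivisors NumberField
open NumberField Module CategoryTheory CategoryTheory.Limits

namespace Literature.Geometry.Kaehler

namespace ComplexTorus

-- `open scoped`: the tree's action of `Aut(ℂ)` on `Hom(K, ℂ)` by composition (`ringEquivCompAction`) is a scoped instance
open scoped Literature.NumberTheory.ComplexMultiplication
open Literature.AlgebraicGeometry.Motives (CMType AbelianVariety)
open Literature.AlgebraicGeometry.HodgeTheory (HodgeConjectureFor complexBetti fermatCMType)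
open Literature.AlgebraicGeometry.VanGeemen1994 (hodgeClassSpan)
open Literature.Barriers.HodgeConjecture (divisorClassesSpan)
open Literature.NumberTheory.ComplexMultiplication (inducedCMType)
open Literature.AlgebraicGeometry.ComplexMultiplication (IsCMTypeRealisation)
open Literature.AlgebraicGeometry.ComplexMultiplication.CyclotomicFermatCMType (fermat_twentyFour_dichotomy)
open Literature.AlgebraicGeometry.Pohlmann1968.Cyclotomic (cmTypeOfResidues)

/-! ### §1 Any level `m > 2` with `φ(m) ≤ 8` -/

section AnyLevel

variable {m : ℕ} [NeZero m] {L : Type} [Field L] [NumberField L] [IsCyclotomicExtension {m} ℚ L] {r s t : ZMod m}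
  {hS : ∀ c : ZMod m, c.val.Coprime m → (c ∈ fermatCMType m r s t ↔ -c ∉ fermatCMType m r s t)}
  {A : AbelianVariety ℂ} {ι : 𝓞 L →+* End A} {θ : L →+* Module.End ℂ (complexBetti A.X 1)}

/-- **`B•(Aⁿ) ⊗ ℂ = D•(Aⁿ) ⊗ ℂ` AND THE HODGE CONJECTURE FOR ALL POWERS OF EVERY REALISATION OF EVERY KOBLITZ–ROHRLICH TYPE `Φ_{H_{r,s,t}}` MODULO
`m`, `m > 2`, `φ(m) ≤ 8`.** [cite: KoblitzRohrlich1978, §1 p. 1184] [cite: Gordon1999HodgeAVSurvey, Thm. 6.4 and §9.3] [cite: Hazama2003CyclicCM, p. 582] -/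
theorem hodgeClassSpan_pow_eq_and_hodgeConjectureFor_pow_fermat_of_totient_le_eight (hm : 2 < m) (h8 : Nat.totient m ≤ 8)
    (hA : IsCMTypeRealisation (cmTypeOfResidues (L := L) (fermatCMType m r s t) hS) A ι θ) (n k : ℕ) :
    hodgeClassSpan (⨁ fun _ : Fin n => A).dim (⨁ fun _ : Fin n => A).X k =
        divisorClassesSpan (⨁ fun _ : Fin n => A).X (⨁ fun _ : Fin n => A).dim k ∧
      HodgeConjectureFor (⨁ fun _ : Fin n => A).dim (⨁ fun _ : Fin n => A).X :=
  ⟨hodgeClassSpan_pow_eq_divisorClassesSpan_of_totient_le_eight inferInstance hm h8 _ hA n k,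
    hodgeConjectureFor_pow_of_totient_le_eight inferInstance hm h8 _ hA n⟩

/-- **The Hodge conjecture for all powers of every realisation of a Koblitz–Rohrlich type modulo `m`, `m > 2`, `φ(m) ≤ 8`.**
[cite: KoblitzRohrlich1978, §1 p. 1184] [cite: Gordon1999HodgeAVSurvey, Thm. 6.4 and §9.3] -/
theorem hodgeConjectureFor_pow_fermat_of_totient_le_eight (hm : 2 < m) (h8 : Nat.totient m ≤ 8)
    (hA : IsCMTypeRealisation (cmTypeOfResidues (L := L) (fermatCMType m r s t) hS) A ι θ) (n : ℕ) :
    HodgeConjectureFor (⨁ fun _ : Fin n => A).dim (⨁ fun _ : Fin n => A).X :=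
  hodgeConjectureFor_pow_of_totient_le_eight inferInstance hm h8 _ hA n

end AnyLevel

/-! ### §2 Level `24`: all triples -/

section TwentyFour

variable {L : Type} [Field L] [NumberField L] [IsCyclotomicExtension {24} ℚ L] {r s t : ZMod 24}
  {hS : ∀ c : ZMod 24, c.val.Coprime 24 → (c ∈ fermatCMType 24 r s t ↔ -c ∉ fermatCMType 24 r s t)}
  {A : AbelianVariety ℂ} {ι : 𝓞 L →+* End A} {θ : L →+* Module.End ℂ (complexBetti A.X 1)}

/-- **LEVEL `24`, EVERY KOBLITZ–ROHRLICH TYPE, EVERY REALISATION, EVERY POWER: `dim A = 4`, `B•(Aⁿ) = D•(Aⁿ)`, Hodge conjecture** — the simple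
class of `H_{1,3,20}` and the four `E⁴`-classes alike. [cite: BauerCosteItzyksonRuelle1997, §3.4] [cite: Gordon1999HodgeAVSurvey, Thm. 6.4 and §9.3] -/
theorem hodgeConjectureFor_pow_fermat_twentyFour (hA : IsCMTypeRealisation (cmTypeOfResidues (L := L) (fermatCMType 24 r s t) hS) A ι θ)
    (n k : ℕ) :
    A.dim = 4 ∧
      hodgeClassSpan (⨁ fun _ : Fin n => A).dim (⨁ fun _ : Fin n => A).X k =
        divisorClassesSpan (⨁ fun _ : Fin n => A).X (⨁ fun _ : Fin n => A).dim k ∧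
      HodgeConjectureFor (⨁ fun _ : Fin n => A).dim (⨁ fun _ : Fin n => A).X :=
  ⟨dim_eq_four_of_isCMTypeRealisation_twentyFour inferInstance hA,
    hodgeClassSpan_pow_eq_and_hodgeConjectureFor_pow_fermat_of_totient_le_eight (by norm_num) (by decide) hA n k⟩

/-- **With the sibling's dichotomy**: for every ADMISSIBLE triple `(r, s, t)` modulo `24` and every realisation `A` of `Φ_{H_{r,s,t}}`: EITHER `A` is a
SIMPLE FOURFOLD (the class of `H_{1,3,20}`) OR `A ∼ E⁴` with `E` a CM elliptic curve (`ℚ(√−6)`, `ℚ(i)`, `ℚ(√−3)`, `ℚ(√−2)`) — and IN BOTH CASES every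
power of `A` satisfies the Hodge conjecture. [cite: BauerCosteItzyksonRuelle1997, §3.4] [cite: KoblitzRohrlich1978, §1 p. 1184]
[cite: Gordon1999HodgeAVSurvey, Thm. 6.4, §9.3, §9.4.2] -/
theorem hodgeConjectureFor_pow_fermat_twentyFour_dichotomy (hr : r ≠ 0) (hs : s ≠ 0) (hrs : r.val + s.val < 24) (ht : t = -(r + s))
    (hA : IsCMTypeRealisation (cmTypeOfResidues (L := L) (fermatCMType 24 r s t) hS) A ι θ) :
    ((A.IsSimple ∧ A.dim = 4) ∨
      (∃ (K₁ : IntermediateField ℚ L) (Φ₁ : CMType K₁) (δ : L), IsCMField K₁ ∧ δ ∈ K₁ ∧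
          K₁ = IntermediateField.adjoin ℚ {δ} ∧ (δ ^ 2 = -6 ∨ δ ^ 2 = -1 ∨ δ ^ 2 = -3 ∨ δ ^ 2 = -2) ∧ Module.finrank ℚ K₁ = 2 ∧ A.dim = 4 ∧
          inducedCMType (algebraMap K₁ L) Φ₁ = cmTypeOfResidues (L := L) (fermatCMType 24 r s t) hS ∧
          ∃ (E : AbelianVariety ℂ) (ιE : 𝓞 K₁ →+* End E) (θE : K₁ →+* Module.End ℂ (complexBetti E.X 1)),
            IsCMTypeRealisation Φ₁ E ιE θE ∧ E.dim = 1 ∧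
            ∃ (P : AbelianVariety ℂ) (π : Fin 4 → (P ⟶ E)), Nonempty (IsLimit (Fan.mk P π)) ∧ ∃ g : A ⟶ P,
              Literature.AlgebraicGeometry.Motives.AbelianVariety.IsIsogeny g)) ∧
      ∀ n : ℕ, HodgeConjectureFor (⨁ fun _ : Fin n => A).dim (⨁ fun _ : Fin n => A).X := by
  refine ⟨?_, fun n ↦ (hodgeConjectureFor_pow_fermat_twentyFour hA n 0).2.2⟩
  rcases fermat_twentyFour_dichotomy hr hs hrs ht hA with ⟨-, h⟩ | ⟨-, h⟩
  · exact Or.inl h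
  · exact Or.inr h

end TwentyFour

end ComplexTorus

end Literature.Geometry.Kaehler

end
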